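import Summits.AnomalousDissipation.AnomalousDissipation.Theorems.SawtoothPulseCascadeK1LocalisedCascadePhaseOneModes
import Summits.AnomalousDissipation.AnomalousDissipation.Theorems.SawtoothPulseCascadeK1LocalisedCascadeFlatCurvature
import Mathlib.Analysis.SpecialFunctions.Integrals.Basic

/-!
# K1loc, line `Spectral` / thin start — helper: THE ROUNDED CHIRP NEXT TO THE EXACT ONE (S-D start)

Helper file of the prover lane on the crux `K1LocalisedCascade` (stmt-AnomalousDissipation-19491), route `SawtoothPulseCascade`
(S-B/S-C assembly seat; START of the amplitude ledger).  Companion of `…ExactChirp`: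
* §1 Bessel on the circle for bounded continuous functions (`sum_sq_norm_fourierCoeff_le_of_norm_le`) and the ROUNDING
  PERTURBATION in `ℓ²`: if `‖g − g₀‖ ≤ ε` pointwise then `√(Σ_{q∈S}‖ĝ(q)‖²) ≤ √(Σ_{q∈S}‖ĝ₀(q)‖²) + ε` for every finite `S`
  (`sqrt_sum_sq_norm_fourierCoeff_le_of_near`); for chirps, `|n·ψ(t) − λ·tri(2πt)/(2π)| ≤ η` gives `ε = 2πη`
  (`sqrt_sum_sq_norm_fourierCoeff_twist_le`);
* §2 the sup distance of the rounded tooth from the exact one: `|roundedSaw δ θ − tri θ| ≤ (2e^{1/2} − 1)·δ`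
  (`abs_roundedSaw_sub_tri_le`, from the exponential moment of `…FlatCurvature`), hence
  `|U_j(y) − tri(2πN_jy)/(2πN_j)| ≤ (2e^{1/2}−1)δ_j/(2πN_j)` (`abs_U_sub_exactProfile_le`).
No definitions; nothing about the crux. [cite: Grafakos2014, Prop. 3.2.7 (3)] [cite: Folland1999, Prop. 2.53 (Gaussian integrals)] [problem: turb]
-/

-- `Summit.<Summit>.<Problem>`: single-conjunct summit, the duplicate namespace segment is deliberate.
set_option linter.dupNamespace false

noncomputable section

namespace Summit.AnomalousDissipation.AnomalousDissipation.Theorems.SawtoothPulseCascade.K1Start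

open MeasureTheory Set Filter Topology UnitAddTorus Function Complex AddCircle intervalIntegral
open scoped Real
open Literature.Analysis Literature.Analysis.FunctionSpaces Literature.Analysis.FunctionSpaces.Torus Literature.Analysis.FluidPDE
open Literature.Analysis.FluidPDE.SawtoothCascade Literature.Analysis.FluidPDE.SawtoothCascade.CascadeParams
open Summit.AnomalousDissipation.AnomalousDissipation.Theorems.SawtoothPulseCascade.K1Flat

/-! ## §1 Bessel on the circle and the rounding perturbation -/

/-- **Bessel for a bounded continuous circle function**: `Σ_{q∈S}‖ĥ(q)‖² ≤ B²` if `‖h‖ ≤ B` pointwise (Parseval on a probability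
space). [cite: Grafakos2014, Prop. 3.2.7 (3)] -/
theorem sum_sq_norm_fourierCoeff_le_of_norm_le {h : UnitAddCircle → ℂ} (hc : Continuous h) {B : ℝ}
    (hB : ∀ x, ‖h x‖ ≤ B) (S : Finset ℤ) : ∑ q ∈ S, ‖fourierCoeff h q‖ ^ 2 ≤ B ^ 2 := by
  have hB0 : 0 ≤ B := (norm_nonneg _).trans (hB 0)
  have hmem : MemLp h 2 haarAddCircle :=
    (memLp_top_of_bound hc.aestronglyMeasurable B (Eventually.of_forall hB)).mono_exponent le_top
  have hP := hasSum_sq_fourierCoeff (hmem.toLp _)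
  have hcoe : ∀ p, fourierCoeff (hmem.toLp _) p = fourierCoeff h p := by
    intro p
    simp only [fourierCoeff]
    exact integral_congr_ae (by filter_upwards [MemLp.coeFn_toLp hmem] with x hx; simp only [hx])
  simp_rw [hcoe] at hP
  have hint : ∫ t, ‖(hmem.toLp _) t‖ ^ 2 ∂haarAddCircle ≤ B ^ 2 := by
    have h1 : ∫ t, ‖(hmem.toLp _) t‖ ^ 2 ∂haarAddCircle = ∫ t, ‖h t‖ ^ 2 ∂haarAddCircle :=
      integral_congr_ae (by filter_upwards [MemLp.coeFn_toLp hmem] with t ht; rw [ht])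
    rw [h1]
    calc ∫ t, ‖h t‖ ^ 2 ∂haarAddCircle ≤ ∫ t, B ^ 2 ∂haarAddCircle :=
          integral_mono_of_nonneg (Eventually.of_forall fun t => sq_nonneg _) (integrable_const _)
            (Eventually.of_forall fun t => pow_le_pow_left₀ (norm_nonneg _) (hB t) 2)
      _ = B ^ 2 := by simp
  exact (sum_le_hasSum S (fun q _ => sq_nonneg _) hP).trans hint

/-- **The rounding perturbation, coefficientwise in `ℓ²`**: if `g = twist ψ n` and `g₀` (continuous) satisfy `‖g − g₀‖ ≤ ε` pointwise,
then `√(Σ_{q∈S}‖ĝ(q)‖²) ≤ √(Σ_{q∈S}‖ĝ₀(q)‖²) + ε` for every finite `S` (Minkowski + Bessel). [cite: Grafakos2014, Prop. 3.2.7 (3)] -/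
theorem sqrt_sum_sq_norm_fourierCoeff_le_of_near {g g₀ : UnitAddCircle → ℂ} (hg : Continuous g) (hg₀ : Continuous g₀)
    {ε : ℝ} (hε : ∀ x, ‖g x - g₀ x‖ ≤ ε) (S : Finset ℤ) :
    Real.sqrt (∑ q ∈ S, ‖fourierCoeff g q‖ ^ 2) ≤ Real.sqrt (∑ q ∈ S, ‖fourierCoeff g₀ q‖ ^ 2) + ε := by
  have hε0 : 0 ≤ ε := (norm_nonneg _).trans (hε 0)
  set h : UnitAddCircle → ℂ := fun x => g x - g₀ x with hh
  have hhc : Continuous h := hg.sub hg₀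
  -- `ĝ = ĝ₀ + ĥ` (linearity of the coefficient integral)
  have hint : ∀ (f : UnitAddCircle → ℂ), Continuous f → ∀ q : ℤ,
      Integrable (fun x : UnitAddCircle => (fourier (-q) x : ℂ) • f x) haarAddCircle := fun f hf q =>
    ((fourier (-q)).continuous.smul hf).integrable_of_hasCompactSupport (HasCompactSupport.of_compactSpace _)
  have hsub : ∀ q, fourierCoeff g q = fourierCoeff g₀ q + fourierCoeff h q := by
    intro q
    simp only [fourierCoeff]
    rw [← integral_add (hint g₀ hg₀ q) (hint h hhc q)]
    refine integral_congr_ae (Eventually.of_forall fun x => ?_)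
    simp only [hh, smul_eq_mul]; ring
  -- Minkowski for the finite sum (Cauchy–Schwarz)
  set a : ℤ → ℝ := fun q => ‖fourierCoeff g₀ q‖ with ha
  set b : ℤ → ℝ := fun q => ‖fourierCoeff h q‖ with hb
  set A := Real.sqrt (∑ q ∈ S, a q ^ 2) with hA
  set B := Real.sqrt (∑ q ∈ S, b q ^ 2) with hB
  have hA0 : 0 ≤ A := Real.sqrt_nonneg _
  have hB0 : 0 ≤ B := Real.sqrt_nonneg _
  have hA2 : A ^ 2 = ∑ q ∈ S, a q ^ 2 := Real.sq_sqrt (Finset.sum_nonneg fun q _ => sq_nonneg _)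
  have hB2 : B ^ 2 = ∑ q ∈ S, b q ^ 2 := Real.sq_sqrt (Finset.sum_nonneg fun q _ => sq_nonneg _)
  have hCS : (∑ q ∈ S, a q * b q) ^ 2 ≤ (∑ q ∈ S, a q ^ 2) * ∑ q ∈ S, b q ^ 2 :=
    Finset.sum_sq_le_sum_mul_sum_of_sq_le_mul S (fun q _ => sq_nonneg (a q)) (fun q _ => sq_nonneg (b q))
      fun q _ => le_of_eq (by ring)
  have hab : ∑ q ∈ S, a q * b q ≤ A * B := by
    have h0 : 0 ≤ ∑ q ∈ S, a q * b q := Finset.sum_nonneg fun q _ => mul_nonneg (norm_nonneg _) (norm_nonneg _)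
    rw [← hA2, ← hB2, ← mul_pow] at hCS
    exact (pow_le_pow_iff_left₀ h0 (mul_nonneg hA0 hB0) two_ne_zero).mp hCS
  have hle : ∑ q ∈ S, ‖fourierCoeff g q‖ ^ 2 ≤ (A + B) ^ 2 := by
    calc ∑ q ∈ S, ‖fourierCoeff g q‖ ^ 2 ≤ ∑ q ∈ S, (a q + b q) ^ 2 :=
          Finset.sum_le_sum fun q _ => by
            rw [hsub q]; exact pow_le_pow_left₀ (norm_nonneg _) (norm_add_le _ _) 2
      _ = ∑ q ∈ S, a q ^ 2 + 2 * ∑ q ∈ S, a q * b q + ∑ q ∈ S, b q ^ 2 := by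
          rw [Finset.mul_sum, ← Finset.sum_add_distrib, ← Finset.sum_add_distrib]
          exact Finset.sum_congr rfl fun q _ => by ring
      _ ≤ (A + B) ^ 2 := by rw [← hA2, ← hB2]; nlinarith
  -- Bessel for `h`
  have hBε : B ≤ ε := by
    have h1 : ∑ q ∈ S, b q ^ 2 ≤ ε ^ 2 := sum_sq_norm_fourierCoeff_le_of_norm_le (h := h) hhc hε S
    calc B = Real.sqrt (∑ q ∈ S, b q ^ 2) := hB
      _ ≤ Real.sqrt (ε ^ 2) := Real.sqrt_le_sqrt h1
      _ = ε := Real.sqrt_sq hε0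
  calc Real.sqrt (∑ q ∈ S, ‖fourierCoeff g q‖ ^ 2) ≤ Real.sqrt ((A + B) ^ 2) := Real.sqrt_le_sqrt hle
    _ = A + B := Real.sqrt_sq (add_nonneg hA0 hB0)
    _ ≤ A + ε := by linarith

/-- **Chirps with nearby phases are uniformly close**: `‖exp(−2πi·a) − exp(−2πi·b)‖ ≤ 2π|a − b|` for real `a, b`. [folklore] -/
theorem norm_exp_neg_two_pi_I_sub_le (a b : ℝ) :
    ‖Complex.exp (-(2 * π * I * a)) - Complex.exp (-(2 * π * I * b))‖ ≤ 2 * π * |a - b| := by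
  -- factor out the unimodular `exp(−2πi b)`
  have hfac : Complex.exp (-(2 * π * I * a)) - Complex.exp (-(2 * π * I * b)) =
      Complex.exp (-(2 * π * I * b)) * (Complex.exp (I * ((-(2 * π * (a - b)) : ℝ) : ℂ)) - 1) := by
    rw [mul_sub, mul_one, ← Complex.exp_add]
    congr 2; push_cast; ring
  have hunit : ‖Complex.exp (-(2 * π * I * b))‖ = 1 := by
    rw [show (-(2 * π * I * b) : ℂ) = ((-(2 * π * b) : ℝ) : ℂ) * I by push_cast; ring, Complex.norm_exp_ofReal_mul_I]
  rw [hfac, norm_mul, hunit, one_mul, Complex.norm_exp_I_mul_ofReal_sub_one, Real.norm_eq_abs, abs_mul,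
    abs_of_pos (by norm_num : (0:ℝ) < 2)]
  have hs := Real.abs_sin_le_abs (x := -(2 * π * (a - b)) / 2)
  calc 2 * |Real.sin (-(2 * π * (a - b)) / 2)| ≤ 2 * |-(2 * π * (a - b)) / 2| := by gcongr
    _ = 2 * π * |a - b| := by
        rw [abs_div, abs_neg, abs_mul, abs_of_pos (by positivity : (0:ℝ) < 2 * π), abs_of_pos (by norm_num : (0:ℝ) < 2)]
        ring

/-- **The rounded chirp next to the exact one**: if `|n·ψ(t) − λ·tri(2πt)/(2π)| ≤ η` for all real `t`, then
`‖twist ψ n − g₀‖ ≤ 2πη` pointwise, hence `√(Σ_{q∈S}‖ĝ_n(q)‖²) ≤ √(Σ_{q∈S}‖ĝ₀(q)‖²) + 2πη` for every finite `S`.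
[cite: Grafakos2014, Prop. 3.2.7 (3)] -/
theorem sqrt_sum_sq_norm_fourierCoeff_twist_le (ψ : ShearProfile) (n lam : ℤ) {g₀ : UnitAddCircle → ℂ}
    (hg₀ : ∀ t : ℝ, g₀ (t : UnitAddCircle) = Complex.exp (-(2 * π * I * lam * ((tri (2 * π * t) / (2 * π) : ℝ) : ℂ))))
    (hg₀c : Continuous g₀) {η : ℝ} (hη : ∀ t : ℝ, |n * ψ t - lam * (tri (2 * π * t) / (2 * π))| ≤ η) (S : Finset ℤ) :
    Real.sqrt (∑ q ∈ S, ‖fourierCoeff (twist ψ n) q‖ ^ 2) ≤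
      Real.sqrt (∑ q ∈ S, ‖fourierCoeff g₀ q‖ ^ 2) + 2 * π * η := by
  refine sqrt_sum_sq_norm_fourierCoeff_le_of_near (continuous_twist ψ n) hg₀c (fun x => ?_) S
  obtain ⟨t, rfl⟩ := QuotientAddGroup.mk_surjective x
  rw [twist_coe, hg₀ t]
  have h := norm_exp_neg_two_pi_I_sub_le (n * ψ t) (lam * (tri (2 * π * t) / (2 * π)))
  have e1 : Complex.exp (-(2 * π * I * ((n * ψ t : ℝ) : ℂ))) = Complex.exp (-(2 * Real.pi * Complex.I * n * ψ t)) := by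
    congr 1; push_cast; ring
  have e2 : Complex.exp (-(2 * π * I * ((lam * (tri (2 * π * t) / (2 * π)) : ℝ) : ℂ))) =
      Complex.exp (-(2 * π * I * lam * ((tri (2 * π * t) / (2 * π) : ℝ) : ℂ))) := by
    congr 1; push_cast; ring
  rw [e1, e2] at h
  exact h.trans (by nlinarith [hη t, Real.pi_pos, abs_nonneg (n * ψ t - lam * (tri (2 * π * t) / (2 * π)))])

/-! ## §2 The rounded tooth is uniformly `O(δ)`-close to the exact one -/

/-- **`|S_δ(θ) − tri θ| ≤ (2e^{1/2} − 1)·δ`** for the rounded sawtooth `S_δ = tri ⋆ g_δ` (`δ > 0`): `tri` is `1`-Lipschitz, so the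
error is at most `∫|u| g_δ(u) du ≤ δ·∫(e^{|u|/δ} − 1)·g_δ ≤ δ(2e^{1/2} − 1)` (`|u|/δ ≤ e^{|u|/δ} − 1`, `…FlatCurvature`).
[cite: Folland1999, Prop. 2.53 (Gaussian integrals)] -/
theorem abs_roundedSaw_sub_tri_le {δ : ℝ} (hδ : 0 < δ) (θ : ℝ) :
    |roundedSaw δ θ - tri θ| ≤ (2 * Real.exp (1 / 2) - 1) * δ := by
  have hG := integral_gaussKernel hδ
  have hGi := integrable_gaussKernel hδ
  obtain ⟨hEi, hE⟩ := integral_exp_mul_abs_gaussKernel_le hδ (1 / δ)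
  have hg0 : ∀ u, 0 ≤ gaussKernel δ u := gaussKernel_nonneg hδ.le
  -- integrability of the two integrands through the Gaussian majorants
  have hmeas1 : AEStronglyMeasurable (fun u => tri (θ - u) * gaussKernel δ u) volume :=
    ((continuous_tri.comp (continuous_const.sub continuous_id)).mul (continuous_gaussKernel δ)).aestronglyMeasurable
  have hint1 : Integrable fun u => tri (θ - u) * gaussKernel δ u := by
    refine (hGi.const_mul (π / 2)).mono' hmeas1 (Eventually.of_forall fun u => ?_)
    rw [Real.norm_eq_abs, abs_mul, abs_of_nonneg (hg0 u)]
    exact mul_le_mul_of_nonneg_right (abs_tri_le _) (hg0 u)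
  have hmeas2 : AEStronglyMeasurable (fun u => |u| * gaussKernel δ u) volume :=
    (continuous_abs.mul (continuous_gaussKernel δ)).aestronglyMeasurable
  -- `|u| g_δ(u) ≤ δ e^{|u|/δ} g_δ(u) − δ g_δ(u)` (from `x + 1 ≤ eˣ`)
  have hkey : ∀ u, |u| * gaussKernel δ u ≤ δ * (Real.exp (1 / δ * |u|) * gaussKernel δ u) - δ * gaussKernel δ u := by
    intro u
    have hx : 1 / δ * |u| + 1 ≤ Real.exp (1 / δ * |u|) := Real.add_one_le_exp _
    have h1 : δ * (1 / δ * |u|) ≤ δ * (Real.exp (1 / δ * |u|) - 1) := mul_le_mul_of_nonneg_left (by linarith) hδ.le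
    have h2 : δ * (1 / δ * |u|) = |u| := by field_simp
    rw [h2] at h1
    nlinarith [hg0 u]
  have hint2 : Integrable fun u => |u| * gaussKernel δ u := by
    refine ((hEi.const_mul δ).sub (hGi.const_mul δ)).mono' hmeas2 (Eventually.of_forall fun u => ?_)
    rw [Real.norm_eq_abs, abs_of_nonneg (mul_nonneg (abs_nonneg u) (hg0 u))]
    exact hkey u
  -- `S_δ(θ) − tri θ = ∫ (tri(θ−u) − tri θ) g_δ(u) du`
  have hdiff : roundedSaw δ θ - tri θ = ∫ u, (tri (θ - u) - tri θ) * gaussKernel δ u := by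
    unfold roundedSaw
    simp_rw [sub_mul]
    rw [integral_sub hint1 (hGi.const_mul _), MeasureTheory.integral_const_mul, hG, mul_one]
  rw [hdiff]
  calc |∫ u, (tri (θ - u) - tri θ) * gaussKernel δ u|
      ≤ ∫ u, |u| * gaussKernel δ u := by
        rw [← Real.norm_eq_abs]
        refine norm_integral_le_of_norm_le hint2 (Eventually.of_forall fun u => ?_)
        rw [Real.norm_eq_abs, abs_mul, abs_of_nonneg (hg0 u)]
        refine mul_le_mul_of_nonneg_right ?_ (hg0 u)
        calc |tri (θ - u) - tri θ| ≤ |θ - u - θ| := abs_tri_sub_tri_le _ _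
          _ = |u| := by rw [show θ - u - θ = -u by ring, abs_neg]
    _ ≤ ∫ u, (δ * (Real.exp (1 / δ * |u|) * gaussKernel δ u) - δ * gaussKernel δ u) :=
        integral_mono_of_nonneg (Eventually.of_forall fun u => mul_nonneg (abs_nonneg u) (hg0 u))
          ((hEi.const_mul δ).sub (hGi.const_mul δ)) (Eventually.of_forall hkey)
    _ = δ * (∫ u, Real.exp (1 / δ * |u|) * gaussKernel δ u) - δ * 1 := by
        rw [integral_sub (hEi.const_mul δ) (hGi.const_mul δ), MeasureTheory.integral_const_mul, MeasureTheory.integral_const_mul, hG]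
    _ ≤ δ * (2 * Real.exp ((1 / δ) ^ 2 * δ ^ 2 / 2)) - δ * 1 := by gcongr
    _ = (2 * Real.exp (1 / 2) - 1) * δ := by
        rw [show (1 / δ) ^ 2 * δ ^ 2 / 2 = (1 / 2 : ℝ) by field_simp]; ring

/-- **The cascade profile next to the exact sawtooth**: `|U_j(y) − tri(2πN_j y)/(2πN_j)| ≤ (2e^{1/2} − 1)·δ_j/(2πN_j)`
(`δ₀ > 0`, `d > 0`, `N_j ≥ 1`). [cite: Folland1999, Prop. 2.53 (Gaussian integrals)] -/
theorem abs_U_sub_exactProfile_le (P : CascadeParams) (hδ₀ : 0 < P.δ₀) (hd : 0 < P.d) {j : ℕ} (hN : 0 < P.N j) (y : ℝ) :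
    |P.U j y - tri (2 * π * P.N j * y) / (2 * π * P.N j)| ≤ (2 * Real.exp (1 / 2) - 1) * P.δ j / (2 * π * P.N j) := by
  have hNr : (0 : ℝ) < P.N j := by exact_mod_cast hN
  have hc : 0 < 2 * π * (P.N j : ℝ) := by positivity
  unfold CascadeParams.U
  rw [← sub_div, abs_div, abs_of_pos hc, div_le_div_iff_of_pos_right hc]
  exact abs_roundedSaw_sub_tri_le (P.δ_pos hδ₀ hd j) _

end Summit.AnomalousDissipation.AnomalousDissipation.Theorems.SawtoothPulseCascade.K1Start
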